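import Summits.QuantumFields.YangMills.Theorems.IR.AfPincerUcFormat

/-!
# Line `haar-coding` — crux `BalabanLadder.IR` (stmt-QuantumFields-19354), ideator `ym-ir-idea-4` g0
# (lens: certified interpolation cluster-region → small-field region; cell pub/ym-ir, R350 B3)

FORMAT C_K («Haar-coded at radius b»).  On every odd torus the Wilson measure `μ_{β}` IS the law of
`Φ(ω)` for an i.i.d. product-Haar link field `ω` (one Haar variable per torus link) and a measurable map
`Φ` that is `b`-LOCAL IN PROBABILITY with tail constant `K`: every output link agrees, off a noise event of
mass `≤ K e^{-k}`, with a function of the noise inside the input ball of radius `k·b` (all `k ≥ 1`).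
This is the finitary-factor-of-i.i.d. format of van den Berg–Steif / Häggström–Steif / Spinka
(Ann. Probab. 48 (2020), arXiv:1803.10578, Thm 1.1: for finite-valued Markov fields, exponential strong
spatial mixing ⇒ ffiid with exponential tails; weak ⇒ power-law tails), transplanted to compact-group link
fields on tori; the INTERPOLATING OBJECT is the transport/coding map `Φ` itself (constructions in the line
card: Lüscher–Kim–Milman coupling flow along a bulk-transition-free action path; scale-telescoped
conditional coders = Bałaban's RG read as a triangular transport; static Langevin-resolvent transport).

STUBS (three, registered) and the kernel-checked composition through the slot-independent generic pincer of
`Theorems/IR/AfPincerUcFormat.lean` §A (`fmtOnset_pinned`, `gapInUnits_of_fmtOnset`):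
* `stub_codedClustering`  (ENGINE, size M, provable now): C_K-coded ⇒ clustering at rate `1/(4b)` per site,
  constant uniform in `β, b, S` — covariance of bounded cylinder observables of INDEPENDENT inputs with
  disjoint input balls vanishes; the tails pay `K e^{-k}`.  Boundary-data-free: no `sup` over exterior data,
  hence none of the wire negatives (`Negative/OuterCertFalseOfWire`, `…TypShellCondUKPcFalseOfWildWire`,
  `…OnsetUcFalseOfMonopoleWire`) has a hypothesis to act on.
* `stub_codedOnset` (research, XL — THE WALL in coding currency): for every compact simple `G` and lattice
  representation, for all large `β` the torus Wilson measures are C_K-coded at SOME radius `b(β)` with ONE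
  tail constant `K`.  Unpinned existence (no unit map), so `Negative/OnsetSharpFalseOfUnpinnedUnit`'s
  parasitic-unit mechanism does not apply; the pin is X's job.
* `stub_codedAF` (research, L–XL — UV∕calibration side, the exact analogue of `AfPincerUc.AFToOnsetUKPc` for
  this format): `Q2 ≤ η` at every unit a factor `T(η)` below the CODING onset.  Its kill-world is the
  coding twin of `Negative/AfOnsetUcFalseOfLateOnset.KSMInf`: optimal coding radius parametrically above
  the non-triviality scale `1/a(β)` (e.g. if only DYNAMICAL codings, radius `≍ ξ^z`, existed).
`irCal_of_coded : stub-statements → AfPincerUc.IRCal` (= the body of `IR`) is a real proof and `IR_of_stubs` concludes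
`Summit.QuantumFields.YangMills.Theses.BalabanLadder.IR` BY NAME from the three named stubs; `sorry` only inside `stub_*`.

HONESTY.  Nothing here proves the Clay Yang–Mills mass gap; the route's `closes` is conditional on
`BalabanLadder.UV ∧ NT ∧ IR`, R4 of the ladder concerns the finite-𝕋⁴ rung `BalabanLadder.UV` only, and this
file proves no stub.
-/

set_option autoImplicit false

noncomputable section

open Filter Topology MeasureTheory
open scoped SchwartzMap
open Literature.MathematicalPhysics.QuantumFieldTheory Literature.MathematicalPhysics.QuantumLattice
open Summit.QuantumFields.YangMills.Cruxes.OSLegsFromFemtoAndGap.DlrCollarTransfer (GapInUnits LowerBounds Q2)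
open Summit.QuantumFields.YangMills.Cruxes.IR.AfPincerUc (fmtSet fmtOnset FmtClustering fmtOnset_pinned
  gapInUnits_of_fmtOnset)

namespace Summit.QuantumFields.YangMills.Cruxes.IR.HaarCoding

/-! ## §1 The format: Haar-coded torus Wilson measures -/

section Format

variable {G : Type} [Group G] [TopologicalSpace G] [IsTopologicalGroup G] [CompactSpace G]
  [MeasurableSpace G] [BorelSpace G]

/-- Sup-distance of two sites of `ℤ⁴`. -/
def supDist (x y : Fin 4 → ℤ) : ℕ := Finset.univ.sup fun i => (x i - y i).natAbs

/-- **Input ball**: the torus links (side `S`) lying below the `ℤ⁴`-links whose base point is within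
sup-distance `R` of the base point of `e` (wrap-around included through `torusEdge`). -/
def inputBall (S : ℕ) (e : Literature.MathematicalPhysics.QuantumLattice.ZdEdge 4) (R : ℕ) : Set (Literature.MathematicalPhysics.QuantumFieldTheory.Edge 4 S) :=
  torusEdge S '' {e' : Literature.MathematicalPhysics.QuantumLattice.ZdEdge 4 | supDist e'.1 e.1 ≤ R}

variable (G) in
/-- **Haar noise**: the i.i.d. product of normalised Haar measures, one per torus link. -/
def haarNoise (S : ℕ) [NeZero S] : Measure (GaugeConfig 4 S G) :=
  Measure.pi fun _ : Literature.MathematicalPhysics.QuantumFieldTheory.Edge 4 S => haarProbability G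

/-- **FORMAT C_K — «the Wilson measure at `β` is Haar-coded at radius `b` with tail constant `K`»**: on every
torus of odd side `2S+1 ≥ b`, `wilsonMeasure ρ β` is the push-forward of the Haar noise under a measurable
map `Φ` such that for every `ℤ⁴`-link `e` and every `k ≥ 1` the output link below `e` agrees with a
measurable function `Ψ` of the noise that depends only on the input ball of radius `k·b` about `e`, off a
noise event of mass `≤ K·e^{-k}` (finitary coding with exponential tails IN UNITS OF `b`). -/
def HaarCoded {N : ℕ} (ρ : G →* Matrix (Fin N) (Fin N) ℂ) (K : ℝ) (β : ℝ) (b : ℕ) : Prop :=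
  ∀ S : ℕ, b ≤ 2 * S + 1 →
    ∃ Φ : GaugeConfig 4 (2 * S + 1) G → GaugeConfig 4 (2 * S + 1) G, Measurable Φ ∧
      (haarNoise G (2 * S + 1)).map Φ = wilsonMeasure (d := 4) (L := 2 * S + 1) ρ β ∧
      ∀ (e : Literature.MathematicalPhysics.QuantumLattice.ZdEdge 4) (k : ℕ), 1 ≤ k →
        ∃ Ψ : GaugeConfig 4 (2 * S + 1) G → G, Measurable Ψ ∧
          DependsOn Ψ (inputBall (2 * S + 1) e (k * b)) ∧
          haarNoise G (2 * S + 1) {ω | Φ ω (torusEdge (2 * S + 1) e) ≠ Ψ ω} ≤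
            ENNReal.ofReal (K * Real.exp (-(k : ℝ)))

end Format

/-! ## §2 Three REGISTERED stubs -/

/-- stub E_cod (ENGINE, M — provable now, group-blind): **Haar-coded ⇒ clustering** at rate `1/(4b)` per
lattice site on tori of side `≥ 4b`, with a constant depending on the two species and `K` only.
Mechanism: cylinder observables of independent inputs with disjoint input balls are independent
(`Measure.pi`), the coding tails pay `K e^{-k}` with `k ≍ t/(2b)`. -/
theorem stub_codedClustering :
    ∀ (G : Type) [Group G] [TopologicalSpace G] [IsTopologicalGroup G] [CompactSpace G]
      [MeasurableSpace G] [BorelSpace G] (r : LatticeRep G) (K : ℝ),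
      FmtClustering r (HaarCoded r.ρ K) (1 / 4 : ℝ) 4 := by
  sorry

/-- stub I_cod (research, XL — THE WALL in coding currency): **uniformly Haar-coded Wilson measures**: for
every compact simple `G` and lattice representation `r` there are ONE tail constant `K` and a threshold `β₂`
such that for every `β ≥ β₂` the torus Wilson measures at `β` are Haar-coded at SOME radius `b(β) ≥ 1`. -/
theorem stub_codedOnset :
    ∀ (G : Type) [Group G] [TopologicalSpace G] [IsTopologicalGroup G] [CompactSpace G],
      IsCompactSimpleLieGroup G →
      letI : MeasurableSpace G := borel G; haveI : BorelSpace G := ⟨rfl⟩;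
      ∀ (r : LatticeRep G), ∃ K β₂ : ℝ, ∀ β : ℝ, β₂ ≤ β → (fmtSet (HaarCoded r.ρ K) β).Nonempty := by
  sorry

/-- stub X_cod (research, L–XL — calibration side): **asymptotic freedom up to the coding onset**: for every
Schwartz `v` supported at positive time and every `η > 0` there is `T(η)` such that, for all large `β`, at
every unit `s` with `s · fmtOnset (HaarCoded r.ρ K) β ≥ T` the smeared truncated two-point function of the
action density obeys `|Q2| ≤ η` along a subsequence of tori (the `hX` hypothesis of `fmtOnset_pinned`). -/
theorem stub_codedAF :
    ∀ (G : Type) [Group G] [TopologicalSpace G] [IsTopologicalGroup G] [CompactSpace G],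
      IsCompactSimpleLieGroup G →
      letI : MeasurableSpace G := borel G; haveI : BorelSpace G := ⟨rfl⟩;
      ∀ (r : LatticeRep G) (K : ℝ) (v : 𝓢(EuclideanSpace ℝ (Fin 4), ℝ)),
        tsupport v ⊆ {y : EuclideanSpace ℝ (Fin 4) | 0 < y 0} →
        ∀ η : ℝ, 0 < η → ∃ T β₁ : ℝ, ∀ β : ℝ, β₁ ≤ β → ∀ s : ℝ, 0 < s →
          T ≤ s * (fmtOnset (HaarCoded r.ρ K) β : ℝ) →
            ∃ᶠ (L : ℕ) in atTop, |Q2 G r β L s (thetaTest 4 v) v| ≤ η := by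
  sorry

/-! ## §2b Typed RUNG (strong coupling — where the format is DECIDED TRUE; not used by `IR_of_stubs`) -/

/-- rung R0 (strong coupling, size L; requested by ym-ir-crit-1): **in a high-noise window `0 ≤ β ≤ β₀(G, r)` the
torus Wilson measures are Haar-coded at a FIXED radius `b₀` with one tail constant** — the cluster-region end of the
lens made literal.  Route: single-link conditional densities w.r.t. Haar lie in `[e^{-cβ}, e^{cβ}]` (minorisation
`≥ e^{-2cβ}·Haar`), so a grand coupling of heat-bath updates driven by the noise resets each link to fresh Haar with
probability `ε(β) → 1`; for `(1-ε)·(2(d-1)·4+1) < 1` disagreement paths are subcritical and coupling-from-the-past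
coalesces with exponential tails (Häggström–Steif, Combin. Probab. Comput. 9 (2000); van den Berg–Steif, Ann. Probab.
27 (1999)); the same contraction is the tree's one-link Dobrushin∕KR window (`shen_zhu_zhu_of_dobrushinCondition`,
`su2_latticeMassGap_of_oneLinkKRModulusSU2`).  With ONE Haar variable per link the unbounded randomness CFTP needs is
extracted through a Borel isomorphism `(G, Haar) ≅ ([0,1], Leb)` mod 0 (G connected ⇒ Haar atomless; Kuratowski —
not yet in Mathlib, hence size L; the sequence-alphabet version in `Lines/telescoped_coding.lean` avoids it). -/
theorem rung_strongCouplingCoder :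
    ∀ (G : Type) [Group G] [TopologicalSpace G] [IsTopologicalGroup G] [CompactSpace G],
      IsCompactSimpleLieGroup G →
      letI : MeasurableSpace G := borel G
      haveI : BorelSpace G := ⟨rfl⟩
      ∀ (r : LatticeRep G), ∃ (K β₀ : ℝ) (b₀ : ℕ), 0 < β₀ ∧ 1 ≤ b₀ ∧
        ∀ β : ℝ, 0 ≤ β → β ≤ β₀ → HaarCoded r.ρ K β b₀ := by
  sorry

/-! ## §3 The kernel-checked composition concluding the ROUTE DECL by name -/

/-- **`E_cod → I_cod → X_cod → IRCal`** (real proof; `AfPincerUc.IRCal` is the body of `BalabanLadder.IR` verbatim):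
per group, the generic pincer at `P := HaarCoded r.ρ K`. -/
theorem irCal_of_coded
    (hE : ∀ (G : Type) [Group G] [TopologicalSpace G] [IsTopologicalGroup G] [CompactSpace G]
      [MeasurableSpace G] [BorelSpace G] (r : LatticeRep G) (K : ℝ),
      FmtClustering r (HaarCoded r.ρ K) (1 / 4 : ℝ) 4)
    (hI : ∀ (G : Type) [Group G] [TopologicalSpace G] [IsTopologicalGroup G] [CompactSpace G],
      IsCompactSimpleLieGroup G →
      letI : MeasurableSpace G := borel G; haveI : BorelSpace G := ⟨rfl⟩;
      ∀ (r : LatticeRep G), ∃ K β₂ : ℝ, ∀ β : ℝ, β₂ ≤ β → (fmtSet (HaarCoded r.ρ K) β).Nonempty)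
    (hX : ∀ (G : Type) [Group G] [TopologicalSpace G] [IsTopologicalGroup G] [CompactSpace G],
      IsCompactSimpleLieGroup G →
      letI : MeasurableSpace G := borel G; haveI : BorelSpace G := ⟨rfl⟩;
      ∀ (r : LatticeRep G) (K : ℝ) (v : 𝓢(EuclideanSpace ℝ (Fin 4), ℝ)),
        tsupport v ⊆ {y : EuclideanSpace ℝ (Fin 4) | 0 < y 0} →
        ∀ η : ℝ, 0 < η → ∃ T β₁ : ℝ, ∀ β : ℝ, β₁ ≤ β → ∀ s : ℝ, 0 < s →
          T ≤ s * (fmtOnset (HaarCoded r.ρ K) β : ℝ) →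
            ∃ᶠ (L : ℕ) in atTop, |Q2 G r β L s (thetaTest 4 v) v| ≤ η) :
    Summit.QuantumFields.YangMills.Cruxes.IR.AfPincerUc.IRCal := by
  intro G _ _ _ _ hG
  letI : MeasurableSpace G := borel G
  haveI : BorelSpace G := ⟨rfl⟩
  intro r a ha _ hlb
  obtain ⟨K, β₂, hon⟩ := hI G hG r
  have hcl : FmtClustering r (HaarCoded r.ρ K) (1 / 4 : ℝ) 4 := hE G r K
  obtain ⟨T, β₆, hpin⟩ := fmtOnset_pinned (HaarCoded r.ρ K) r a ha hlb (hX G hG r K)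
  exact gapInUnits_of_fmtOnset r a ha (by norm_num) hcl hon hpin

/-- **The route decl BY NAME from the three named stubs** (consumes exactly `stub_codedClustering`, `stub_codedOnset`,
`stub_codedAF`; `sorry` only inside the stubs; `IR`'s body is `IRCal` verbatim). -/
theorem IR_of_stubs : Summit.QuantumFields.YangMills.Theses.BalabanLadder.IR := by
  have h : Summit.QuantumFields.YangMills.Cruxes.IR.AfPincerUc.IRCal :=
    irCal_of_coded stub_codedClustering stub_codedOnset stub_codedAF
  delta Summit.QuantumFields.YangMills.Theses.BalabanLadder.IR
  delta Summit.QuantumFields.YangMills.Cruxes.IR.AfPincerUc.IRCal at h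
  exact h

end Summit.QuantumFields.YangMills.Cruxes.IR.HaarCoding

end
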